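import Summits.BirchSwinnertonDyer.Rank2.LambdaTransportDoorAtTwoZeroAtMinusTwo
import Summits.BirchSwinnertonDyer.Rank2.LambdaTransportDoorAtTwoMembersNonCM
import Literature.NumberTheory.EllipticCurves.Greenberg1999.SelmerCorankQuadraticTwistLambdaBoundProofs
import HarnessLib

/-!
# Door (F*) at `p = 2`: the fact pack from SEVEN named facts (Greenberg Thm. 1.9's corank clause is now a
# tree THEOREM), `MembersNonCM` discharged — the outcome-of-record theorem with the fewest displayed inputs

Cell `bsd-rank2`, seat `bsd-rank2-eng-2` GEN 4; follow-up of `Rank2/LambdaTransportDoorAtTwoZeroAtMinusTwo.lean`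
(p505328) and `…MembersNonCM.lean` (p506144), after lit GEN 16's p510542
(`Literature/…/Greenberg1999/SelmerCorankQuadraticTwistLambdaBoundProofs.lean`): clause (d) of the door's
`PublishedInputsAtTwo` — `s₂(E/ℚ) + s₂(E^{(2)}/ℚ) ≤ λ(X₂(E/ℚ_∞))` for `E` good ordinary at `2` — is the THEOREM
`Greenberg1999.selmerCorank_add_selmerCorank_quadraticTwist_two_le_of_isOrdinaryAt` (no named fact). Hence:

* `publishedInputsAtTwo_of_seven_named_facts` — `PublishedInputsAtTwo` from Kato 18.4 at `2` (all curves),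
  Tao–Ziegler, Matsuno 2008 Thm. 4.2 / Prop. 6.2, Greenberg Prop. 5.14 at `2`, Monsky, Carayol (seven named
  facts; (d) and (b)'s family instance are theorems);
* `selmerCorankEqOrderEqThreeOnOddFamily_of_19272_seven` — the director's outcome-of-record theorem with the
  displayed inputs {seven named facts, `OrdConversePublishedInputsAtTwo`, `RootNumberFacts`, `ReferenceFacts`,
  item 19272 `OrdEisensteinHalfAtTwo`} — `MembersNonCM` is no longer a hypothesis (`membersNonCM_holds`, p506144);
* `leaf_of_seven_named_facts` — the same keyed on the door's crux `MembersLambdaHalfAtTwo` instead of 19272.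

THEOREMS ONLY (no definition, no named fact, no `sorry`). PARTITION: none — r_an ≥ 2, summit axis S0;
TWIN (D-0056): n/a. B1 honesty: glue; every open input displayed by name; no S0 motion.

References: R. Greenberg, LNM 1716 (1999) Thm. 1.9 [GreenbergLNM1716]; K. Kato, *Astérisque* 295 (2004) Thm. 18.4
[Kato2004Asterisque]; T. Tao, T. Ziegler, *Acta Math.* 201 (2008) [TaoZiegler2008]; K. Matsuno (2008) [Matsuno2008].
-/

set_option linter.dupNamespace false

noncomputable section

open PowerSeries WeierstrassCurve Literature.NumberTheory.EllipticCurves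
  Literature.NumberTheory.EllipticCurves.ModularForms Literature.NumberTheory.Sieve

namespace Summit.BirchSwinnertonDyer.Rank2.LambdaTransportDoor

open Summit.BirchSwinnertonDyer.Rank2.Family81517

/-- **`PublishedInputsAtTwo` from SEVEN named facts** (clause (d) by lit GEN 16's theorem
`Greenberg1999.selmerCorank_add_selmerCorank_quadraticTwist_two_le_of_isOrdinaryAt`).
[cite: GreenbergLNM1716, Thm. 1.9] [cite: Kato2004Asterisque, Thm. 18.4] [cite: TaoZiegler2008, Thm. 1.3] -/
theorem publishedInputsAtTwo_of_seven_named_facts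
    (hKato : ∀ (W : WeierstrassCurve ℚ) [W.IsElliptic] [W.IsGloballyMinimal] ⦃N : ℕ⦄ [NeZero N]
      (f : CuspForm (CongruenceSubgroup.Gamma0 N) 2),
      kato_selmerCorank_le_order_padicLFunction_allPrimes W 2 (f := f))
    (hTZ : TaoZiegler2008_polynomialProgressions)
    (h42 : matsuno2008_thm42_lambda_transport_two) (h62 : matsuno2008_prop62_lambda_fullTwoTorsion_two)
    (h514 : Greenberg1999.prop514_isTorsion_mu_eq_zero_two)
    (hMon : monsky_selmerCorank_two_mod_two_eq)
    (hCar : ∀ ⦃N : ℕ⦄ [NeZero N], IsNewformOf.level_eq_conductorNorm (N := N)) :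
    PublishedInputsAtTwo :=
  ⟨Family81517.kato_clause_of_allPrimes hKato, Family81517.infinite_admissibleF_oddSign_of_taoZiegler hTZ,
    ⟨h42, h62, h514⟩,
    fun W _ _ ↦ Greenberg1999.selmerCorank_add_selmerCorank_quadraticTwist_two_le_of_isOrdinaryAt W,
    hMon, hCar⟩

/-- **The T-r3₂ leaf from SEVEN named facts + the two elementary support packs + the crux
`MembersLambdaHalfAtTwo`.** [cite: Kato2004Asterisque, Thm. 18.4] [cite: MazurTateTeitelbaum1986Invent, §I.14] -/
theorem leaf_of_seven_named_facts
    (hKato : ∀ (W : WeierstrassCurve ℚ) [W.IsElliptic] [W.IsGloballyMinimal] ⦃N : ℕ⦄ [NeZero N]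
      (f : CuspForm (CongruenceSubgroup.Gamma0 N) 2),
      kato_selmerCorank_le_order_padicLFunction_allPrimes W 2 (f := f))
    (hTZ : TaoZiegler2008_polynomialProgressions)
    (h42 : matsuno2008_thm42_lambda_transport_two) (h62 : matsuno2008_prop62_lambda_fullTwoTorsion_two)
    (h514 : Greenberg1999.prop514_isTorsion_mu_eq_zero_two)
    (hMon : monsky_selmerCorank_two_mod_two_eq)
    (hCar : ∀ ⦃N : ℕ⦄ [NeZero N], IsNewformOf.level_eq_conductorNorm (N := N))
    (hRN : RootNumberFacts) (hR : ReferenceFacts) (hL : MembersLambdaHalfAtTwo) :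
    SelmerCorankEqOrderEqThreeOnOddFamily :=
  closes' (publishedInputsAtTwo_of_seven_named_facts hKato hTZ h42 h62 h514 hMon hCar) hRN hR hL

/-- **OUTCOME OF RECORD, sharpened: the T-r3₂ leaf from SEVEN named facts, the 2adic cell's published pack,
the two elementary support packs `RootNumberFacts` / `ReferenceFacts`, and item 19272** — `MembersNonCM` is
discharged by `membersNonCM_holds` (p506144) and Greenberg Thm. 1.9's clause by lit's theorem (p510542).
[cite: Kato2004Asterisque, Thm. 18.4] [cite: GreenbergLNM1716, Thm. 1.9] -/
theorem selmerCorankEqOrderEqThreeOnOddFamily_of_19272_seven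
    (hKato : ∀ (W : WeierstrassCurve ℚ) [W.IsElliptic] [W.IsGloballyMinimal] ⦃N : ℕ⦄ [NeZero N]
      (f : CuspForm (CongruenceSubgroup.Gamma0 N) 2),
      kato_selmerCorank_le_order_padicLFunction_allPrimes W 2 (f := f))
    (hTZ : TaoZiegler2008_polynomialProgressions)
    (h42 : matsuno2008_thm42_lambda_transport_two) (h62 : matsuno2008_prop62_lambda_fullTwoTorsion_two)
    (h514 : Greenberg1999.prop514_isTorsion_mu_eq_zero_two)
    (hMon : monsky_selmerCorank_two_mod_two_eq)
    (hCar : ∀ ⦃N : ℕ⦄ [NeZero N], IsNewformOf.level_eq_conductorNorm (N := N))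
    (hP : Literature.Uncategorized.OrdConversePublishedInputsAtTwo) (hRN : RootNumberFacts) (hR : ReferenceFacts)
    (h19272 : Summit.BirchSwinnertonDyer.BirchSwinnertonDyer.Theorems.OrdHalvesAtTwo.OrdEisensteinHalfAtTwo) :
    SelmerCorankEqOrderEqThreeOnOddFamily :=
  closes_of_ordEisensteinHalfAtTwo (publishedInputsAtTwo_of_seven_named_facts hKato hTZ h42 h62 h514 hMon hCar)
    hP hRN hR membersNonCM_holds h19272

end Summit.BirchSwinnertonDyer.Rank2.LambdaTransportDoor

end
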